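import Summits.QuantumFields.QCD.Theorems.SpectralDefectExtinctionWegnerEstimateStubCountLeResolvent
import Summits.QuantumFields.QCD.Theorems.SpectralDefectExtinctionWegnerEstimateStubLocalTraceRegular

/-!
# Stub `resolventLocalSpectralSum` of line `Sketch` (skeleton "ResolventCell", gen 2) for crux
`SpectralDefectExtinction.WegnerEstimate` (item stmt-QuantumFields-8966)

For a Hermitian matrix `A : Matrix n n ℂ`, an index set `P : Finset n` and `ε > 0`, the `P`-local
trace of the imaginary part of the resolvent is the eigenvector-mass-weighted spectral sum
`Σ_{p ∈ P} Im ((A − iε)⁻¹)_{pp} = Σ_j w_j · ε / (λ_j² + ε²)`, `w_j = Σ_{p ∈ P} |u_j(p)|²`,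
where `A u_j = λ_j u_j` is the orthonormal eigenbasis `hA.eigenvectorBasis` with eigenvalues
`hA.eigenvalues`.

Proof: with `V = hA.eigenvectorUnitary` (columns `u_j`, i.e. `V p j = u_j p`) one has
`(A − iε)⁻¹ = V diag((λ_j − iε)⁻¹) V⋆` (`localTraceRegular_inv_eq`), hence
`((A − iε)⁻¹)_{pp} = Σ_j (λ_j − iε)⁻¹ |V p j|²` (`localTraceRegular_conj_diag_apply`) with imaginary
part `Σ_j |u_j p|² ε/(λ_j² + ε²)` (`countLeResolvent_inv_im`); summing over `p ∈ P` and exchanging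
the two finite sums gives the claim.
-/

noncomputable section

namespace Summit.QuantumFields.QCD.Cruxes.WegnerEstimate.ResolventCell

open scoped Matrix BigOperators ComplexOrder
open Matrix

/-- **Stub `resolventLocalSpectralSum` (deterministic linear algebra).**  For a Hermitian
`A : Matrix n n ℂ`, `P : Finset n` and `ε > 0`,
`Σ_{p ∈ P} Im ((A − iε)⁻¹)_{pp} = Σ_j (Σ_{p ∈ P} ‖u_j p‖²) · ε / (λ_j² + ε²)`, where
`u_j = hA.eigenvectorBasis j` and `λ_j = hA.eigenvalues j` (spectral theorem:
`(A − iε)⁻¹ = V diag((λ_j − iε)⁻¹) V⋆`, `V p j = u_j p`, `Im (λ − iε)⁻¹ = ε/(λ² + ε²)`). -/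
theorem stub_resolventLocalSpectralSum :
    ∀ (n : Type) [Fintype n] [DecidableEq n] (A : Matrix n n ℂ) (hA : A.IsHermitian) (P : Finset n) (ε : ℝ),
      0 < ε →
      ∑ p ∈ P, ((A - ((ε : ℂ) * Complex.I) • (1 : Matrix n n ℂ))⁻¹ p p).im =
        ∑ j : n, (∑ p ∈ P, ‖(hA.eigenvectorBasis j) p‖ ^ 2) * (ε / (hA.eigenvalues j ^ 2 + ε ^ 2)) := by
  intro n _ _ A hA P ε hε
  -- spectral form of the resolvent (sibling stub `localTraceRegular`)
  obtain ⟨-, hinv⟩ := localTraceRegular_inv_eq hA hε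
  -- the diagonal entries, one at a time
  have hdiag : ∀ p : n, ((A - ((ε : ℂ) * Complex.I) • (1 : Matrix n n ℂ))⁻¹ p p).im =
      ∑ j : n, ‖(hA.eigenvectorBasis j) p‖ ^ 2 * (ε / (hA.eigenvalues j ^ 2 + ε ^ 2)) := by
    intro p
    rw [hinv, localTraceRegular_conj_diag_apply, Complex.im_sum]
    refine Finset.sum_congr rfl fun j _ => ?_
    rw [Complex.im_mul_ofReal, countLeResolvent_inv_im, Matrix.IsHermitian.eigenvectorUnitary_apply,
      Complex.normSq_eq_norm_sq, mul_comm]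
  -- sum over `p ∈ P` and exchange the two finite sums
  rw [Finset.sum_congr rfl fun p _ => hdiag p, Finset.sum_comm]
  exact Finset.sum_congr rfl fun j _ => (Finset.sum_mul _ _ _).symm

end Summit.QuantumFields.QCD.Cruxes.WegnerEstimate.ResolventCell

end
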